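import Mathlib

/-!
# Imbrie (2016), §4.2.1 "Graphical Sums": three closed-form constants of the graph-counting paragraph — REPRODUCTION (kernel-checked
arithmetic only)

CITATION HEADER (lean-in-tree rule 2026-08-18). J. Z. Imbrie, *On many-body localization for quantum spin chains*, J. Stat. Phys.
**163** (2016) 998–1048, doi 10.1007/s10955-016-1508-x, arXiv:1403.7837 [ImbrieJSP2016], §4.2.1 ("Graphical sums"), verbatim:
(a) "This means that short graphs can be controlled with a combinatoric factor O(L^n_i)n^{2n/9} = O(L^n_i)(n!)^{2/9}. … Then the
condition for short graphs implies that the ratio ℓ_p(1+δ) : ℓ_pδ/2 + ℓ_f must be at least 7:1. Hence ℓ_f ≤ ℓ_p(1−5δ/2)/7. Allowing as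
before a factor ≤ 2 between the sizes of pinned and floating graphs, we see that n_f ≤ 2n_p(1−5δ/2)/7. Hence the ratio n_f/n is no
greater than (2−5δ)/(9−5δ) ≤ 2/9, which completes the proof of the claim."  (b) "Since the g_{i'} each have size ≥ L_i, there are no
more than |g_{j'}|/L_i factors of L_i. So we obtain a bound exp(O(1)|g_{j'}|L_i^{−1} log L_i) times a product of (2/9)th-power
factorials. In view of the geometric increase, L_i = (15/8)^i, the product over i < j gives a bound c^{|g_{j'}|}(g_{j'}!)^{2/9}, which is
just what is required. One way to think of this estimate is to compute the 'combinatoric factor per site' L_i^{1/L_i} by dividing each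
factor L_i amongst L_i steps. As the product of L_i^{1/L_i} is bounded, the combinatorics are under control. Note that super-linear
growth of L_i with i is required."
WHAT IS REPRODUCED (the exact ARITHMETIC inside the quoted clauses, nothing else): `floatingLength_le` and `floatingCount_ratio_le` (the two
"Hence" steps of (a): 7(ℓ_pδ/2 + ℓ_f) ≤ ℓ_p(1+δ) ⟹ ℓ_f ≤ ℓ_p(1−5δ/2)/7; n_f ≤ 2n_p(1−5δ/2)/7, n_p + n_f ≤ n ⟹ n_f/n ≤ (2−5δ)/(9−5δ)),
`floatingFraction_le` / `floatingFraction_antitone` ((2−5δ)/(9−5δ) ≤ 2/9, decreasing in δ); `pow_mul_self_rpow_le` (n^{2n/9} ≤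
(eⁿ)^{2/9}(n!)^{2/9}: "n^{2n/9} = (n!)^{2/9}" holds up to an admissible cⁿ, from nⁿ/n! ≤ eⁿ); `hasSum_log_scale_div_scale` (for L_i = (15/8)^i:
Σ_{i≥0} log(L_i)/L_i = (120/49)·log(15/8) exactly — the series behind "the product of L_i^{1/L_i} is bounded"), `prod_scale_rpow_inv_le`
(every finite product Π_{i<N} L_i^{1/L_i} ≤ (15/8)^{120/49} [≈ 4.662; the decimal is not certified here]) and, for the clause "super-linear
growth of L_i with i is required", `not_summable_log_div_self` (with L_i = i the same series diverges).  WHAT IS NOT CLAIMED: the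
combinatorial premises of (a) (the 7:1 length ratio, the factor ≤ 2 between graph sizes, the doubling-back of gap graphs), the inductive
graph-counting lemma of §4.2.1 itself (jump steps, metric comparability, Leibniz counts), any operator estimate, anything about LLA.  These are
the "(rev. 4) §4.2.1" rows of the audit cell's SURVIVAL.md §5 (cell `pub-imbrie`, unit b2b-imbrie-2 gen 3, build tag b2b): audit-cell
arithmetic, NOT a statement that any part of the paper's §4 stands.
-/

namespace Literature.MathematicalPhysics.QuantumLattice.Imbrie2016

open Finset Real

/-- First "Hence" of the floating-graph count (§4.2.1): if the ratio ℓ_p(1+δ) : (ℓ_pδ/2 + ℓ_f) is at least 7 : 1, then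
ℓ_f ≤ ℓ_p(1 − 5δ/2)/7. [cite: ImbrieJSP2016, §4.2.1 "Hence ℓ_f ≤ ℓ_p(1−5δ/2)/7"] -/
theorem floatingLength_le {lp lf δ : ℝ} (h : 7 * (lp * δ / 2 + lf) ≤ lp * (1 + δ)) : lf ≤ lp * (1 - 5 * δ / 2) / 7 := by
  linarith

/-- Second "Hence" of the floating-graph count (§4.2.1): if n_f ≤ 2n_p(1 − 5δ/2)/7 with n_p > 0, n_f ≥ 0 and n_p + n_f ≤ n (n = number of
subgraphs), then n_f/n ≤ (2 − 5δ)/(9 − 5δ), for every δ ≤ 2/5. [cite: ImbrieJSP2016, §4.2.1 "Hence the ratio n_f/n is no greater than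
(2−5δ)/(9−5δ)"] -/
theorem floatingCount_ratio_le {np nf n δ : ℝ} (hδ : 5 * δ ≤ 2) (hnp : 0 < np) (hnf : 0 ≤ nf)
    (h : nf ≤ 2 * np * (1 - 5 * δ / 2) / 7) (hn : np + nf ≤ n) : nf / n ≤ (2 - 5 * δ) / (9 - 5 * δ) := by
  have hnpos : 0 < n := by linarith
  rw [div_le_div_iff₀ hnpos (by linarith)]
  nlinarith

/-- The floating-graph fraction bound of §4.2.1: (2 − 5δ)/(9 − 5δ) ≤ 2/9 whenever 0 ≤ δ and 5δ < 9 (equality at δ = 0).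
[cite: ImbrieJSP2016, §4.2.1 "no greater than (2−5δ)/(9−5δ) ≤ 2/9"] -/
theorem floatingFraction_le (δ : ℝ) (h0 : 0 ≤ δ) (h1 : 5 * δ < 9) : (2 - 5 * δ) / (9 - 5 * δ) ≤ 2 / 9 := by
  rw [div_le_div_iff₀ (by linarith) (by norm_num)]
  nlinarith

/-- The floating-graph fraction is antitone in δ on [0, 9/5): larger δ only helps. [cite: ImbrieJSP2016, §4.2.1] -/
theorem floatingFraction_antitone {δ δ' : ℝ} (h : δ ≤ δ') (h1 : 5 * δ' < 9) :
    (2 - 5 * δ') / (9 - 5 * δ') ≤ (2 - 5 * δ) / (9 - 5 * δ) := by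
  rw [div_le_div_iff₀ (by linarith) (by linarith)]
  nlinarith

/-- "n^{2n/9} = (n!)^{2/9}" up to an admissible cⁿ: n^{2n/9} ≤ (eⁿ)^{2/9} · (n!)^{2/9}, from nⁿ/n! ≤ eⁿ.
[cite: ImbrieJSP2016, §4.2.1 "a combinatoric factor O(L_i^n) n^{2n/9} = O(L_i^n)(n!)^{2/9}"] -/
theorem pow_mul_self_rpow_le (n : ℕ) :
    ((n : ℝ) ^ n) ^ (2 / 9 : ℝ) ≤ (Real.exp n) ^ (2 / 9 : ℝ) * ((n.factorial : ℝ)) ^ (2 / 9 : ℝ) := by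
  have hfac : (0 : ℝ) < n.factorial := by positivity
  have h1 : (n : ℝ) ^ n / n.factorial ≤ Real.exp n := Real.pow_div_factorial_le_exp (x := (n : ℝ)) (by positivity) n
  have h2 : (n : ℝ) ^ n ≤ Real.exp n * n.factorial := by
    rwa [div_le_iff₀ hfac] at h1
  calc ((n : ℝ) ^ n) ^ (2 / 9 : ℝ) ≤ (Real.exp n * n.factorial) ^ (2 / 9 : ℝ) :=
        Real.rpow_le_rpow (by positivity) h2 (by norm_num)
    _ = (Real.exp n) ^ (2 / 9 : ℝ) * ((n.factorial : ℝ)) ^ (2 / 9 : ℝ) :=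
        Real.mul_rpow (by positivity) (by positivity)

/-- The series behind "the product of L_i^{1/L_i} is bounded" for the scales L_i = (15/8)^i: Σ_i log(L_i)/L_i = Σ_i i·log(15/8)·(8/15)^i
= log(15/8)·(8/15)/(7/15)² = (120/49)·log(15/8) exactly (≈ 1.5394; decimal not certified). Geometric growth of L_i is what makes it finite
("super-linear growth of L_i with i is required"). [cite: ImbrieJSP2016, §4.2.1] -/
theorem hasSum_log_scale_div_scale :
    HasSum (fun i : ℕ => Real.log ((15 / 8 : ℝ) ^ i) / (15 / 8 : ℝ) ^ i) (Real.log (15 / 8) * (120 / 49)) := by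
  have hr : ‖(8 / 15 : ℝ)‖ < 1 := by
    rw [Real.norm_eq_abs, abs_of_nonneg (by norm_num)]; norm_num
  have H := (hasSum_coe_mul_geometric_of_norm_lt_one hr).mul_left (Real.log (15 / 8))
  have hval : Real.log (15 / 8) * ((8 / 15 : ℝ) / (1 - 8 / 15) ^ 2) = Real.log (15 / 8) * (120 / 49) := by norm_num
  have hfun : (fun i : ℕ => Real.log ((15 / 8 : ℝ) ^ i) / (15 / 8 : ℝ) ^ i)
      = (fun i : ℕ => Real.log (15 / 8) * ((i : ℝ) * (8 / 15 : ℝ) ^ i)) := by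
    funext i
    rw [Real.log_pow, div_eq_mul_inv, ← inv_pow, show ((15 / 8 : ℝ))⁻¹ = 8 / 15 by norm_num]
    ring
  rw [hfun, ← hval]
  exact H

/-- Hence every finite product Π_{i<N} L_i^{1/L_i} is at most (15/8)^{120/49} (= exp((120/49) log(15/8)) ≈ 4.662; decimal not certified):
the step-uniform constant in "c^{|g_{j'}|}". [cite: ImbrieJSP2016, §4.2.1 "As the product of L_i^{1/L_i} is bounded, the combinatorics are
under control"] -/
theorem prod_scale_rpow_inv_le (N : ℕ) :
    ∏ i ∈ Finset.range N, ((15 / 8 : ℝ) ^ i) ^ (1 / (15 / 8 : ℝ) ^ i) ≤ (15 / 8 : ℝ) ^ (120 / 49 : ℝ) := by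
  have hL : ∀ i : ℕ, (0 : ℝ) < (15 / 8 : ℝ) ^ i := fun i => by positivity
  have hterm : ∀ i : ℕ, ((15 / 8 : ℝ) ^ i) ^ (1 / (15 / 8 : ℝ) ^ i)
      = Real.exp (Real.log ((15 / 8 : ℝ) ^ i) / (15 / 8 : ℝ) ^ i) := by
    intro i
    rw [Real.rpow_def_of_pos (hL i), mul_one_div]
  have hnonneg : ∀ i : ℕ, 0 ≤ Real.log ((15 / 8 : ℝ) ^ i) / (15 / 8 : ℝ) ^ i := by
    intro i
    apply div_nonneg _ (hL i).le
    rw [Real.log_pow]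
    exact mul_nonneg (by positivity) (Real.log_nonneg (by norm_num))
  have hsum : ∑ i ∈ Finset.range N, Real.log ((15 / 8 : ℝ) ^ i) / (15 / 8 : ℝ) ^ i ≤ Real.log (15 / 8) * (120 / 49) :=
    sum_le_hasSum (Finset.range N) (fun i _ => hnonneg i) hasSum_log_scale_div_scale
  calc ∏ i ∈ Finset.range N, ((15 / 8 : ℝ) ^ i) ^ (1 / (15 / 8 : ℝ) ^ i)
      = ∏ i ∈ Finset.range N, Real.exp (Real.log ((15 / 8 : ℝ) ^ i) / (15 / 8 : ℝ) ^ i) :=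
        Finset.prod_congr rfl (fun i _ => hterm i)
    _ = Real.exp (∑ i ∈ Finset.range N, Real.log ((15 / 8 : ℝ) ^ i) / (15 / 8 : ℝ) ^ i) := (Real.exp_sum _ _).symm
    _ ≤ Real.exp (Real.log (15 / 8) * (120 / 49)) := Real.exp_le_exp.mpr hsum
    _ = (15 / 8 : ℝ) ^ (120 / 49 : ℝ) := (Real.rpow_def_of_pos (by norm_num) _).symm

/-- For contrast ("super-linear growth of L_i with i is required"): with LINEAR scales L_i = i the same series diverges — log(i)/i ≥ 1/i
for i ≥ 3 and Σ 1/i = ∞. Stated as: i ↦ log(i)/i is not summable over ℕ. [cite: ImbrieJSP2016, §4.2.1] -/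
theorem not_summable_log_div_self : ¬ Summable (fun i : ℕ => Real.log i / i) := by
  intro h
  set g : ℕ → ℝ := fun i => if 3 ≤ i then 1 / (i : ℝ) else 0 with hg_def
  have hg0 : ∀ i, 0 ≤ g i := by
    intro i; simp only [hg_def]; split_ifs <;> positivity
  have hgf : ∀ i : ℕ, g i ≤ Real.log i / i := by
    intro i
    simp only [hg_def]
    split_ifs with hi
    · have hi' : (3 : ℝ) ≤ i := by exact_mod_cast hi
      have hlog : 1 ≤ Real.log i := by
        rw [Real.le_log_iff_exp_le (by linarith)]
        have := Real.exp_one_lt_d9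
        linarith
      exact div_le_div_of_nonneg_right hlog (by linarith)
    · exact div_nonneg (Real.log_natCast_nonneg i) (by positivity)
  have hg : Summable g := Summable.of_nonneg_of_le hg0 hgf h
  have h1 : Summable (fun n : ℕ => (1 : ℝ) / ((n + 3 : ℕ) : ℝ)) := by
    have := (summable_nat_add_iff 3).mpr hg
    refine this.congr (fun n => ?_)
    simp [hg_def]
  have h2 : Summable (fun n : ℕ => (1 : ℝ) / (n : ℝ)) := (summable_nat_add_iff 3).mp h1
  exact Real.not_summable_one_div_natCast h2

end Literature.MathematicalPhysics.QuantumLattice.Imbrie2016
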